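import Mathlib
import Literature.RingTheory.MvPolynomial.IteratedDerivations
import HarnessLib

/-!
# Truncated quadratic modules of a ball and the perturbation lemma

Topic `Literature/AlgebraicGeometry/HyperbolicPolynomials`. Elementary positivity certificates
used to make Helton–Nie's moment construction exact on a *small* Euclidean ball
(`LocalExactness.lean`), replacing the degree-bounded Positivstellensätze of Helton–Nie
(Math. Program. 122 (2010), Thms 27–29) by the classical observation that the constants lie in the
*interior* of an Archimedean quadratic module (Marshall, *Positive polynomials and sums of
squares*, AMS 2008, Prop. 5.2.3 / Cor. 5.2.4): if `N - Σ Xᵢ²` belongs to a quadratic module `Q`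
then so does `c ± m` for every monomial `m` and a constant `c` depending only on the degree, with
explicit sums-of-squares identities and hence explicit degree bounds.

## Contents (namespace `Literature.AlgebraicGeometry.HyperbolicPolynomials`)

* `InQM D q f` — `f` is a sum of squares `a²` and of products `q · b²` with `deg a, deg b ≤ D`
  (the degree-`D` truncation of the quadratic module generated by `q`), as an inductive predicate;
  closure under sums, non-negative scalars, multiplication by squares, shifts `X ↦ X + c`, and
  non-negativity under every linear functional non-negative on such squares (`InQM.linear_nonneg`).
* `unitBallPoly = 1 - Σ Xᵢ²` and the Archimedean identities for the *shifted* ball polynomial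
  `shift c unitBallPoly = 1 - Σ (Xᵢ + cᵢ)²`, uniformly in the centre `Σ cᵢ² ≤ 1`:
  `4 - Σ Xᵢ² = Σ (Xᵢ + 2cᵢ)² + 2(1 - Σcᵢ²) + 2·(1 - Σ(Xᵢ+cᵢ)²)`, `4^{|γ|} - (X^γ)²`,
  `2^{|γ|} ± X^γ`, and the polarised `η(Xᵢ² + Xⱼ²) + e·XᵢXⱼX^γ` for `|e| ≤ η / 2^{|γ|+1}`.
* `InQM.of_quadratic_perturbation` — **the perturbation lemma**: a polynomial
  `Φ = Σᵢⱼ Aᵢⱼ XᵢXⱼ + Φ₃` with `A - δ·1 ⪰ 0`, `Φ₃` supported in degrees `3 … D₀` and all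
  coefficients of `Φ₃` at most `δ / (4 (D₀+1)^k 2^{D₀})` in absolute value, lies in
  `InQM D₀ (shift c unitBallPoly)` for every centre with `Σ cᵢ² ≤ 1`.

## References

* [Marshall2008] M. Marshall, *Positive polynomials and sums of squares*, AMS Surveys 146 (2008),
  Prop. 5.2.3, Cor. 5.2.4 (Archimedean quadratic modules).
* [HeltonNie2008] J. W. Helton, J. Nie, Math. Program. 122 (2010) 21–64, §2.2 and §6 (the role of
  degree bounds in the exactness of the Putinar-type lifted LMI).
* J. B. Lasserre, *Convex sets with semidefinite representation*, Math. Program. 120 (2009)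
  457–477, Thm 2 (PP-BDR ⇒ exactness of the lifted LMI), as quoted in [HeltonNie2008, §2.2].
-/

noncomputable section

open MvPolynomial
open scoped BigOperators Matrix

namespace Literature.AlgebraicGeometry.HyperbolicPolynomials

open Literature.RingTheory.MvPolynomial (shift shift_X eval_shift totalDegree_shift_le)

variable {σ : Type*}

/-! ### Truncated quadratic modules -/

/-- `InQM D q f`: `f` is a finite sum of squares `a²` and products `q·b²` of polynomials of total
degree `≤ D` — the degree-`D` truncation of the quadratic module generated by `q`
(Helton–Nie's "Putinar-type" certificates `σ₀ + σ₁ q`, `σᵢ` SOS with degree bounds).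
[cite: HeltonNie2008, §2.2 (PP-BDR)] -/
inductive InQM (D : ℕ) (q : MvPolynomial σ ℝ) : MvPolynomial σ ℝ → Prop
  | zero : InQM D q 0
  | sq (a : MvPolynomial σ ℝ) (ha : a.totalDegree ≤ D) : InQM D q (a ^ 2)
  | qsq (b : MvPolynomial σ ℝ) (hb : b.totalDegree ≤ D) : InQM D q (q * b ^ 2)
  | add {f g : MvPolynomial σ ℝ} : InQM D q f → InQM D q g → InQM D q (f + g)

namespace InQM

variable {D : ℕ} {q f g : MvPolynomial σ ℝ}

/-- Transport along an equality. [folklore] -/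
theorem of_eq {f g : MvPolynomial σ ℝ} (h : f = g) (hg : InQM D q g) : InQM D q f := h ▸ hg

/-- Monotonicity in the degree bound. [folklore] -/
theorem mono {D D' : ℕ} (hD : D ≤ D') (hf : InQM D q f) : InQM D' q f := by
  induction hf with
  | zero => exact zero
  | sq a ha => exact sq a (ha.trans hD)
  | qsq b hb => exact qsq b (hb.trans hD)
  | add _ _ ihf ihg => exact add ihf ihg

/-- Finite sums. [folklore] -/
theorem sum {ι : Type*} (s : Finset ι) (F : ι → MvPolynomial σ ℝ) (h : ∀ i ∈ s, InQM D q (F i)) :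
    InQM D q (∑ i ∈ s, F i) := by
  classical
  induction s using Finset.induction_on with
  | empty => simpa using zero
  | insert a s has ih =>
    rw [Finset.sum_insert has]
    exact add (h a (Finset.mem_insert_self a s)) (ih fun i hi => h i (Finset.mem_insert_of_mem hi))

/-- `deg (C c * a) ≤ deg a`. [folklore] -/
theorem _root_.Literature.AlgebraicGeometry.HyperbolicPolynomials.totalDegree_C_mul_le'
    (c : ℝ) (a : MvPolynomial σ ℝ) : (C c * a).totalDegree ≤ a.totalDegree := by
  rw [C_mul']; exact totalDegree_smul_le c a

/-- Non-negative scalar multiples. [folklore] -/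
theorem smul {c : ℝ} (hc : 0 ≤ c) (hf : InQM D q f) : InQM D q (C c * f) := by
  induction hf with
  | zero => rw [mul_zero]; exact zero
  | sq a ha =>
    refine of_eq (g := (C (Real.sqrt c) * a) ^ 2) ?_ (sq _ ((totalDegree_C_mul_le' _ _).trans ha))
    rw [mul_pow, ← map_pow, Real.sq_sqrt hc]
  | qsq b hb =>
    refine of_eq (g := q * (C (Real.sqrt c) * b) ^ 2) ?_ (qsq _ ((totalDegree_C_mul_le' _ _).trans hb))
    rw [mul_pow, ← map_pow, Real.sq_sqrt hc]; ring
  | add _ _ ihf ihg => rw [mul_add]; exact add ihf ihg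

/-- Non-negative constants. [folklore] -/
theorem const {c : ℝ} (hc : 0 ≤ c) : InQM D q (C c) := by
  refine of_eq (g := (C (Real.sqrt c)) ^ 2) ?_ (sq _ (by rw [totalDegree_C]; exact Nat.zero_le _))
  rw [← map_pow, Real.sq_sqrt hc]

/-- The generator itself (`q · 1²`). [folklore] -/
theorem gen : InQM D q q :=
  of_eq (g := q * 1 ^ 2) (by ring) (qsq 1 (by rw [totalDegree_one]; exact Nat.zero_le _))

/-- Multiplication by a square raises the degree bound by the degree of its root. [folklore] -/
theorem mul_sq {r : ℕ} (hf : InQM D q f) (a : MvPolynomial σ ℝ) (ha : a.totalDegree ≤ r) :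
    InQM (D + r) q (f * a ^ 2) := by
  induction hf with
  | zero => rw [zero_mul]; exact zero
  | sq b hb =>
    refine of_eq (g := (b * a) ^ 2) (by ring) (sq _ ((totalDegree_mul _ _).trans ?_))
    exact Nat.add_le_add hb ha
  | qsq b hb =>
    refine of_eq (g := q * (b * a) ^ 2) (by ring) (qsq _ ((totalDegree_mul _ _).trans ?_))
    exact Nat.add_le_add hb ha
  | add _ _ ihf ihg => rw [add_mul]; exact add ihf ihg

/-- Multiplication by a square on the left. [folklore] -/
theorem sq_mul {r : ℕ} (a : MvPolynomial σ ℝ) (ha : a.totalDegree ≤ r) (hf : InQM D q f) :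
    InQM (D + r) q (a ^ 2 * f) := by
  rw [mul_comm]; exact hf.mul_sq a ha

/-- **Positivity under functionals**: a linear functional that is non-negative on squares of
polynomials of degree `≤ D` and on `q` times such squares is non-negative on `InQM D q`.
[cite: HeltonNie2008, §2.2 (exactness of the lifted LMI from PP-BDR)] -/
theorem linear_nonneg (L : MvPolynomial σ ℝ →ₗ[ℝ] ℝ)
    (h1 : ∀ a : MvPolynomial σ ℝ, a.totalDegree ≤ D → 0 ≤ L (a ^ 2))
    (h2 : ∀ b : MvPolynomial σ ℝ, b.totalDegree ≤ D → 0 ≤ L (q * b ^ 2)) (hf : InQM D q f) :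
    0 ≤ L f := by
  induction hf with
  | zero => rw [map_zero]
  | sq a ha => exact h1 a ha
  | qsq b hb => exact h2 b hb
  | add _ _ ihf ihg => rw [map_add]; exact add_nonneg ihf ihg

/-- Point evaluations at points where `q ≥ 0` are such functionals. [folklore] -/
theorem eval_nonneg (x : σ → ℝ) (hx : 0 ≤ MvPolynomial.eval x q) (hf : InQM D q f) :
    0 ≤ MvPolynomial.eval x f := by
  induction hf with
  | zero => rw [map_zero]
  | sq a _ => rw [map_pow]; exact sq_nonneg _
  | qsq b _ => rw [map_mul, map_pow]; exact mul_nonneg hx (sq_nonneg _)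
  | add _ _ ihf ihg => rw [map_add]; exact add_nonneg ihf ihg

/-- **Shift invariance**: `X ↦ X + c` maps `InQM D q` to `InQM D (shift c q)` (shifts preserve
squares and do not raise total degrees). [folklore] -/
theorem shift_mem (c : σ → ℝ) (hf : InQM D q f) : InQM D (shift c q) (shift c f) := by
  induction hf with
  | zero => rw [map_zero]; exact zero
  | sq a ha => rw [map_pow]; exact sq _ ((totalDegree_shift_le c a).trans ha)
  | qsq b hb => rw [map_mul, map_pow]; exact qsq _ ((totalDegree_shift_le c b).trans hb)
  | add _ _ ihf ihg => rw [map_add]; exact add ihf ihg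

end InQM

/-- Removing a positive constant factor. [folklore] -/
theorem InQM.of_const_mul {D : ℕ} {q f : MvPolynomial σ ℝ} {c : ℝ} (hc : 0 < c)
    (h : InQM D q (C c * f)) : InQM D q f := by
  have := h.smul (inv_nonneg.2 hc.le)
  rwa [← mul_assoc, ← map_mul, inv_mul_cancel₀ hc.ne', map_one, one_mul] at this

/-- `C N₁ - f² ∈ Q`, `C N₂ - g² ∈ Q`, `N₂ ≥ 0` give `C (N₁N₂) - (fg)² ∈ Q`
(`= N₂ (N₁ - f²) + f² (N₂ - g²)`). [cite: Marshall2008, Prop. 5.2.3] -/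
theorem InQM.const_sub_mul_sq {D D' r : ℕ} {q f g : MvPolynomial σ ℝ} {N₁ N₂ : ℝ} (hN₂ : 0 ≤ N₂)
    (hf : InQM D q (C N₁ - f ^ 2)) (hg : InQM D' q (C N₂ - g ^ 2)) (hr : f.totalDegree ≤ r) :
    InQM (max D (D' + r)) q (C (N₁ * N₂) - (f * g) ^ 2) := by
  refine InQM.of_eq (g := C N₂ * (C N₁ - f ^ 2) + (C N₂ - g ^ 2) * f ^ 2) ?_ ?_
  · rw [map_mul]; ring
  · exact ((hf.smul hN₂).mono (le_max_left _ _)).add ((hg.mul_sq f hr).mono (le_max_right _ _))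

/-! ### The ball polynomial, its shifts, and the Archimedean identities -/

section Ball

variable [Fintype σ]

/-- The unit-ball polynomial `1 - Σ Xᵢ²`. [cite: HeltonNie2008, §2.2 (archimedean condition)] -/
def unitBallPoly (σ : Type*) [Fintype σ] : MvPolynomial σ ℝ := 1 - ∑ i, X i ^ 2

omit [Fintype σ] in
/-- [folklore] -/
theorem shift_C (c : σ → ℝ) (r : ℝ) : shift c (C r : MvPolynomial σ ℝ) = C r := by
  simp [shift]

/-- The shifted ball polynomial `1 - Σ (Xᵢ + cᵢ)²`. [folklore] -/
theorem shift_unitBallPoly (c : σ → ℝ) :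
    shift c (unitBallPoly σ) = 1 - ∑ i, (X i + C (c i)) ^ 2 := by
  simp only [unitBallPoly, map_sub, map_one, map_sum, map_pow, shift_X]

/-- [folklore] -/
theorem eval_unitBallPoly (x : σ → ℝ) : MvPolynomial.eval x (unitBallPoly σ) = 1 - ∑ i, x i ^ 2 := by
  simp [unitBallPoly]

/-- [folklore] -/
theorem eval_shift_unitBallPoly (c x : σ → ℝ) :
    MvPolynomial.eval x (shift c (unitBallPoly σ)) = 1 - ∑ i, (x i + c i) ^ 2 := by
  simp [shift_unitBallPoly]

/-- **Archimedean identity**: `4 - Σ Xᵢ² = Σ (Xᵢ + 2cᵢ)² + 2(1 - Σ cᵢ²) + 2 · (1 - Σ (Xᵢ + cᵢ)²)`,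
so `4 - Σ Xᵢ²` is in the quadratic module of every shifted unit ball containing the origin-centred
picture (`Σ cᵢ² ≤ 1`), with degree-`1` certificates. [cite: Marshall2008, Cor. 5.2.4] -/
theorem inQM_four_sub_sumSq (c : σ → ℝ) (hc : ∑ i, c i ^ 2 ≤ 1) {D : ℕ} (hD : 1 ≤ D) :
    InQM D (shift c (unitBallPoly σ)) (C 4 - ∑ i, X i ^ 2) := by
  have h1 : ∀ i : σ, (X i + 2 * C (c i)) ^ 2 - 2 * (X i + C (c i)) ^ 2 + X i ^ 2 - 2 * C (c i) ^ 2 =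
      (0 : MvPolynomial σ ℝ) := fun i => by ring
  have hsum := Finset.sum_eq_zero fun i (_ : i ∈ (Finset.univ : Finset σ)) => h1 i
  simp only [Finset.sum_sub_distrib, Finset.sum_add_distrib, ← Finset.mul_sum] at hsum
  have key : (C 4 - ∑ i, X i ^ 2 : MvPolynomial σ ℝ) =
      ∑ i, (X i + C (2 * c i)) ^ 2 + C (Real.sqrt (2 * (1 - ∑ i, c i ^ 2))) ^ 2 +
        shift c (unitBallPoly σ) * C (Real.sqrt 2) ^ 2 := by
    rw [← map_pow, ← map_pow, Real.sq_sqrt (by norm_num : (0 : ℝ) ≤ 2),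
      Real.sq_sqrt (by linarith), shift_unitBallPoly]
    simp only [map_mul, map_sub, map_one, map_sum, map_pow, map_ofNat]
    linear_combination (-1 : MvPolynomial σ ℝ) * hsum
  refine InQM.of_eq key (InQM.add (InQM.add (InQM.sum _ _ fun i _ => InQM.sq _ ?_) (InQM.sq _ ?_))
    (InQM.qsq _ ?_))
  · refine (totalDegree_add _ _).trans (max_le ?_ ?_)
    · rw [totalDegree_X]; exact hD
    · rw [totalDegree_C]; exact Nat.zero_le _
  · rw [totalDegree_C]; exact Nat.zero_le _
  · rw [totalDegree_C]; exact Nat.zero_le _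

/-- `4 - Xᵢ² = (4 - Σ Xⱼ²) + Σ_{j ≠ i} Xⱼ²`. [cite: Marshall2008, Cor. 5.2.4] -/
theorem inQM_four_sub_X_sq [DecidableEq σ] (c : σ → ℝ) (hc : ∑ i, c i ^ 2 ≤ 1) {D : ℕ} (hD : 1 ≤ D)
    (i : σ) : InQM D (shift c (unitBallPoly σ)) (C 4 - X i ^ 2) := by
  have key : (C 4 - X i ^ 2 : MvPolynomial σ ℝ) =
      (C 4 - ∑ j, X j ^ 2) + ∑ j ∈ Finset.univ.erase i, X j ^ 2 := by
    rw [← Finset.add_sum_erase _ _ (Finset.mem_univ i)]; ring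
  refine InQM.of_eq key ((inQM_four_sub_sumSq c hc hD).add (InQM.sum _ _ fun j _ => InQM.sq _ ?_))
  rw [totalDegree_X]; exact hD

/-- The monomial of a word: `X_{w₁} ⋯ X_{w_r}`. [folklore] -/
def wordMonomial (w : List σ) : MvPolynomial σ ℝ := (w.map X).prod

omit [Fintype σ] in
/-- The empty word gives `1`. [folklore] -/
@[simp] theorem wordMonomial_nil : wordMonomial ([] : List σ) = 1 := rfl

omit [Fintype σ] in
/-- Unfolding along `a :: w`. [folklore] -/
@[simp] theorem wordMonomial_cons (a : σ) (w : List σ) :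
    wordMonomial (a :: w) = X a * wordMonomial w := rfl

omit [Fintype σ] in
/-- `deg (X_{w₁} ⋯ X_{w_r}) ≤ r`. [folklore] -/
theorem totalDegree_wordMonomial_le (w : List σ) : (wordMonomial w).totalDegree ≤ w.length := by
  induction w with
  | nil => simp
  | cons a w ih =>
    rw [wordMonomial_cons, List.length_cons]
    refine (totalDegree_mul _ _).trans ?_
    rw [totalDegree_X]; omega

omit [Fintype σ] in
/-- The monomial of a word is the monomial of the exponent it counts. [folklore] -/
theorem wordMonomial_eq_monomial (w : List σ) :
    wordMonomial w = monomial (Literature.RingTheory.MvPolynomial.counts w) 1 := by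
  induction w with
  | nil => simp [wordMonomial]
  | cons a w ih =>
    rw [wordMonomial_cons, Literature.RingTheory.MvPolynomial.counts_cons, monomial_single_add,
      pow_one, ih]

/-- `4^{r} - (X_{w₁} ⋯ X_{w_r})²` lies in the module, with degree-`(r+1)` certificates.
[cite: Marshall2008, Prop. 5.2.3] -/
theorem inQM_pow_sub_wordMonomial_sq [DecidableEq σ] (c : σ → ℝ) (hc : ∑ i, c i ^ 2 ≤ 1)
    (w : List σ) :
    InQM (w.length + 1) (shift c (unitBallPoly σ)) (C ((4 : ℝ) ^ w.length) - wordMonomial w ^ 2) := by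
  induction w with
  | nil => simpa using (InQM.zero : InQM 1 (shift c (unitBallPoly σ)) 0)
  | cons a w ih =>
    have h4 := inQM_four_sub_X_sq c hc (le_refl 1) a
    have := InQM.const_sub_mul_sq (by norm_num : (0 : ℝ) ≤ 4) ih h4 (totalDegree_wordMonomial_le w)
    refine (InQM.of_eq ?_ this).mono (max_le (by simp) (by simp; omega))
    rw [wordMonomial_cons, List.length_cons, pow_succ, mul_comm (X a)]

/-- `2^r ± X^w` lies in the module: `2K(K ± m) = (K ± m)² + (K² - m²)`.
[cite: Marshall2008, Prop. 5.2.3] -/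
theorem inQM_pow_add_smul_wordMonomial [DecidableEq σ] (c : σ → ℝ) (hc : ∑ i, c i ^ 2 ≤ 1)
    (w : List σ) {s : ℝ} (hs : |s| ≤ 1) :
    InQM (w.length + 1) (shift c (unitBallPoly σ))
      (C ((2 : ℝ) ^ w.length) + C s * wordMonomial w) := by
  obtain ⟨K, hK⟩ : ∃ K : ℝ, K = (2 : ℝ) ^ w.length := ⟨_, rfl⟩
  rw [← hK]
  have hKpos : 0 < K := by rw [hK]; positivity
  have hdeg : ∀ t : ℝ, (C K + C t * wordMonomial w).totalDegree ≤ w.length + 1 := fun t =>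
    (totalDegree_add _ _).trans (max_le (by rw [totalDegree_C]; exact Nat.zero_le _)
      (((totalDegree_C_mul_le' _ _).trans (totalDegree_wordMonomial_le w)).trans (Nat.le_succ _)))
  have h4K : (4 : ℝ) ^ w.length = K ^ 2 := by
    rw [hK, ← pow_mul, mul_comm, pow_mul]; norm_num
  -- `K ± m`
  have hpm : ∀ t : ℝ, t = 1 ∨ t = -1 →
      InQM (w.length + 1) (shift c (unitBallPoly σ)) (C K + C t * wordMonomial w) := by
    intro t ht
    have ht2 : t ^ 2 = 1 := by rcases ht with rfl | rfl <;> norm_num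
    have hCt : (C t : MvPolynomial σ ℝ) ^ 2 = 1 := by rw [← map_pow, ht2, map_one]
    refine InQM.of_const_mul (mul_pos two_pos hKpos) (InQM.of_eq ?_
      ((InQM.sq _ (hdeg t)).add (inQM_pow_sub_wordMonomial_sq c hc w)))
    rw [h4K, map_mul, map_pow, map_ofNat]
    linear_combination (-(wordMonomial w ^ 2)) * hCt
  -- convex combination
  have ha : 0 ≤ (1 + s) / 2 := by have := (abs_le.1 hs).1; linarith
  have hb : 0 ≤ (1 - s) / 2 := by have := (abs_le.1 hs).2; linarith
  refine InQM.of_eq ?_ (((hpm 1 (Or.inl rfl)).smul ha).add ((hpm (-1) (Or.inr rfl)).smul hb))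
  have e1 : (C s : MvPolynomial σ ℝ) = C ((1 + s) / 2) * C (1 : ℝ) + C ((1 - s) / 2) * C (-1 : ℝ) := by
    rw [← map_mul, ← map_mul, ← map_add]; congr 1; ring
  have e2 : (C K : MvPolynomial σ ℝ) = C ((1 + s) / 2) * C K + C ((1 - s) / 2) * C K := by
    rw [← map_mul, ← map_mul, ← map_add]; congr 1; ring
  linear_combination e2 + wordMonomial w * e1

/-- Rescaled: `C η + C e · X^w` is in the module whenever `|e| 2^{|w|} ≤ η`.
[cite: Marshall2008, Prop. 5.2.3] -/
theorem inQM_const_add_smul_wordMonomial [DecidableEq σ] (c : σ → ℝ) (hc : ∑ i, c i ^ 2 ≤ 1)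
    (w : List σ) {η e : ℝ} (hη : 0 < η) (he : |e| * (2 : ℝ) ^ w.length ≤ η) :
    InQM (w.length + 1) (shift c (unitBallPoly σ)) (C η + C e * wordMonomial w) := by
  obtain ⟨K, hK⟩ : ∃ K : ℝ, K = (2 : ℝ) ^ w.length := ⟨_, rfl⟩
  have hKpos : 0 < K := by rw [hK]; positivity
  rw [← hK] at he
  have hs : |e * K / η| ≤ 1 := by
    rw [abs_div, abs_mul, abs_of_pos hKpos, abs_of_pos hη, div_le_one hη]; exact he
  have h := (inQM_pow_add_smul_wordMonomial c hc w hs).smul (div_pos hη hKpos).le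
  rw [← hK] at h
  refine InQM.of_eq ?_ h
  have hval : η / K * (e * K / η) = e := by field_simp
  rw [mul_add, ← mul_assoc, ← map_mul, ← map_mul, div_mul_cancel₀ _ hKpos.ne', hval]

/-- **Polarised Archimedean identity**: `η (Xᵢ² + Xⱼ²) + e · XᵢXⱼX^w` is in the module whenever
`|e| 2^{|w|+1} ≤ η`, with degree-`(|w|+2)` certificates:
`4η(Xᵢ²+Xⱼ²) + 4e XᵢXⱼm = Xᵢ²(2η - 2em) + Xⱼ²(2η - 2em) + (Xᵢ+Xⱼ)²(η + 2em) + η(Xᵢ-Xⱼ)²`.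
[cite: Marshall2008, Prop. 5.2.3] -/
theorem inQM_polarised [DecidableEq σ] (c : σ → ℝ) (hc : ∑ i, c i ^ 2 ≤ 1) (i j : σ)
    (w : List σ) {η e : ℝ} (hη : 0 < η) (he : |e| * (2 : ℝ) ^ (w.length + 1) ≤ η) :
    InQM (w.length + 2) (shift c (unitBallPoly σ))
      (C η * (X i ^ 2 + X j ^ 2) + C e * (X i * X j * wordMonomial w)) := by
  have he1 : |(-(2 * e))| * (2 : ℝ) ^ w.length ≤ 2 * η := by
    rw [abs_neg, abs_mul, abs_two, pow_succ] at *; nlinarith [abs_nonneg e]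
  have he2 : |2 * e| * (2 : ℝ) ^ w.length ≤ η := by
    rw [abs_mul, abs_two]; rw [pow_succ] at he; nlinarith [abs_nonneg e]
  have hA := inQM_const_add_smul_wordMonomial c hc w (by linarith : 0 < 2 * η) he1
  have hB := inQM_const_add_smul_wordMonomial c hc w hη he2
  have hX : ∀ l : σ, (X l : MvPolynomial σ ℝ).totalDegree ≤ 1 := fun l => by rw [totalDegree_X]
  have hXX : (X i + X j : MvPolynomial σ ℝ).totalDegree ≤ 1 :=
    (totalDegree_add _ _).trans (max_le (hX i) (hX j))
  have h4 : InQM (w.length + 2) (shift c (unitBallPoly σ))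
      ((X i) ^ 2 * (C (2 * η) + C (-(2 * e)) * wordMonomial w) +
        (X j) ^ 2 * (C (2 * η) + C (-(2 * e)) * wordMonomial w) +
        (X i + X j) ^ 2 * (C η + C (2 * e) * wordMonomial w) +
        (C (Real.sqrt η) * (X i - X j)) ^ 2) :=
    (((hA.sq_mul _ (hX i)).add (hA.sq_mul _ (hX j))).add (hB.sq_mul _ hXX)).add
      (InQM.sq _ (((totalDegree_C_mul_le' _ _).trans ((totalDegree_sub _ _).trans
        (max_le (hX i) (hX j)))).trans (by omega)))
  refine InQM.of_const_mul (by norm_num : (0 : ℝ) < 4) (InQM.of_eq ?_ h4)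
  rw [mul_pow, ← map_pow, Real.sq_sqrt hη.le]
  simp only [map_mul, map_neg, map_ofNat]
  ring

end Ball

/-! ### Positive semidefinite quadratic forms and the perturbation lemma -/

section Quadratic

open scoped MatrixOrder

variable [Fintype σ]

/-- The quadratic polynomial `Σᵢⱼ Aᵢⱼ XᵢXⱼ` of a matrix. [folklore] -/
def quadPoly (A : Matrix σ σ ℝ) : MvPolynomial σ ℝ := ∑ i, ∑ j, C (A i j) * X i * X j

/-- [folklore] -/
theorem eval_quadPoly (A : Matrix σ σ ℝ) (v : σ → ℝ) :
    MvPolynomial.eval v (quadPoly A) = ∑ i, ∑ j, A i j * v i * v j := by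
  simp [quadPoly]

/-- [folklore] -/
theorem quadPoly_sub (A B : Matrix σ σ ℝ) : quadPoly (A - B) = quadPoly A - quadPoly B := by
  simp only [quadPoly, Matrix.sub_apply, map_sub, sub_mul, Finset.sum_sub_distrib]

/-- `quadPoly (δ • 1) = δ Σ Xᵢ²`. [folklore] -/
theorem quadPoly_smul_one [DecidableEq σ] (δ : ℝ) :
    quadPoly (δ • (1 : Matrix σ σ ℝ)) = C δ * ∑ i, X i ^ 2 := by
  simp only [quadPoly, Matrix.smul_apply, Matrix.one_apply, smul_eq_mul, mul_ite, mul_one, mul_zero]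
  rw [Finset.mul_sum]
  refine Finset.sum_congr rfl fun i _ => ?_
  rw [Finset.sum_eq_single i (fun j _ hji => by rw [if_neg (Ne.symm hji), map_zero, zero_mul, zero_mul])
    (fun h => absurd (Finset.mem_univ i) h), if_pos rfl]
  ring

/-- `deg (Σᵢ aᵢ Xᵢ) ≤ 1`. [folklore] -/
theorem totalDegree_linearForm_le (a : σ → ℝ) :
    (∑ i, C (a i) * X i : MvPolynomial σ ℝ).totalDegree ≤ 1 :=
  totalDegree_finsetSum_le fun i _ => (totalDegree_C_mul_le' _ _).trans (by rw [totalDegree_X])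

/-- **A positive semidefinite quadratic form is a sum of squares of linear forms**
(`A = S·S` with `S = √A` symmetric, so `Σ Aᵢⱼ XᵢXⱼ = Σ_l (Σᵢ S_{li} Xᵢ)²`). [folklore] -/
theorem inQM_quadPoly_of_posSemidef [DecidableEq σ] {A : Matrix σ σ ℝ} (hA : A.PosSemidef) {D : ℕ}
    (hD : 1 ≤ D) (q : MvPolynomial σ ℝ) : InQM D q (quadPoly A) := by
  obtain ⟨S, hS⟩ : ∃ S : Matrix σ σ ℝ, S = CFC.sqrt A := ⟨_, rfl⟩
  have hSS : S * S = A := by rw [hS]; exact CFC.sqrt_mul_sqrt_self A hA.nonneg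
  have hSsa : IsSelfAdjoint S := by rw [hS]; exact (CFC.sqrt_nonneg A).isSelfAdjoint
  have hSt : ∀ i j, S j i = S i j := fun i j => by
    have h := congrFun (congrFun hSsa.star_eq i) j
    rw [Matrix.star_apply, star_trivial] at h
    exact h
  have hAij : ∀ i j, A i j = ∑ l, S l i * S l j := fun i j => by
    rw [← hSS, Matrix.mul_apply]
    exact Finset.sum_congr rfl fun l _ => by rw [hSt i l]
  have key : quadPoly A = ∑ l, (∑ i, C (S l i) * X i) ^ 2 := by
    calc quadPoly A = ∑ i, ∑ j, ∑ l, C (S l i) * X i * (C (S l j) * X j) := by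
          simp only [quadPoly, hAij, map_sum, map_mul, Finset.sum_mul]
          exact Finset.sum_congr rfl fun i _ => Finset.sum_congr rfl fun j _ =>
            Finset.sum_congr rfl fun l _ => by ring
      _ = ∑ i, ∑ l, ∑ j, C (S l i) * X i * (C (S l j) * X j) :=
          Finset.sum_congr rfl fun i _ => Finset.sum_comm
      _ = ∑ l, ∑ i, ∑ j, C (S l i) * X i * (C (S l j) * X j) := Finset.sum_comm
      _ = ∑ l, (∑ i, C (S l i) * X i) ^ 2 :=
          Finset.sum_congr rfl fun l _ => by rw [sq, Finset.sum_mul_sum]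
  exact InQM.of_eq key (InQM.sum _ _ fun l _ => InQM.sq _ ((totalDegree_linearForm_le _).trans hD))

/-- From the quadratic-form inequality `δ Σ vᵢ² ≤ Σ Aᵢⱼ vᵢvⱼ` for a symmetric `A` to
`A - δ·1 ⪰ 0`. [folklore] -/
theorem posSemidef_sub_smul_one [DecidableEq σ] {A : Matrix σ σ ℝ} (hsymm : A.IsSymm) {δ : ℝ}
    (h : ∀ v : σ → ℝ, δ * ∑ i, v i ^ 2 ≤ ∑ i, ∑ j, A i j * v i * v j) :
    (A - δ • (1 : Matrix σ σ ℝ)).PosSemidef := by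
  refine Matrix.PosSemidef.of_dotProduct_mulVec_nonneg ?_ fun v => ?_
  · have h1 : (A - δ • (1 : Matrix σ σ ℝ)).IsSymm := by
      rw [Matrix.IsSymm, Matrix.transpose_sub, Matrix.transpose_smul, Matrix.transpose_one, hsymm]
    -- real symmetric matrices are Hermitian
    rw [Matrix.IsHermitian, Matrix.conjTranspose, h1.eq]
    ext i j; simp
  · have hv := h v
    have h1 : ∀ i, ((A - δ • (1 : Matrix σ σ ℝ)) *ᵥ v) i = ∑ j, A i j * v j - δ * v i := by
      intro i
      simp only [Matrix.mulVec, dotProduct, Matrix.sub_apply, Matrix.smul_apply, Matrix.one_apply,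
        smul_eq_mul, mul_ite, mul_one, mul_zero, sub_mul, Finset.sum_sub_distrib, ite_mul, zero_mul]
      rw [Finset.sum_ite_eq]; simp
    have hq : star v ⬝ᵥ ((A - δ • (1 : Matrix σ σ ℝ)) *ᵥ v) =
        ∑ i, ∑ j, A i j * v i * v j - δ * ∑ i, v i ^ 2 := by
      simp only [star_trivial, dotProduct, h1, mul_sub, Finset.sum_sub_distrib, Finset.mul_sum]
      congr 1
      · exact Finset.sum_congr rfl fun i _ => Finset.sum_congr rfl fun j _ => by ring
      · exact Finset.sum_congr rfl fun i _ => by ring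
    rw [hq]; linarith

omit [Fintype σ] in
/-- An exponent of a polynomial of total degree `≤ D₀` has all entries `≤ D₀`. [folklore] -/
theorem apply_le_of_mem_support {Φ : MvPolynomial σ ℝ} {D₀ : ℕ} (hdeg : Φ.totalDegree ≤ D₀)
    {α : σ →₀ ℕ} (hα : α ∈ Φ.support) (i : σ) : α i ≤ D₀ := by
  classical
  have h1 : α i ≤ α.degree := by
    by_cases hi : i ∈ α.support
    · rw [Finsupp.degree]; exact Finset.single_le_sum (fun j _ => Nat.zero_le _) hi
    · rw [Finsupp.notMem_support_iff.1 hi]; exact Nat.zero_le _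
  exact h1.trans ((le_totalDegree hα).trans hdeg)

/-- The support of a polynomial of total degree `≤ D₀` has at most `(D₀+1)^{#σ}` elements.
[folklore] -/
theorem card_support_le_of_totalDegree_le {Φ : MvPolynomial σ ℝ} {D₀ : ℕ}
    (hdeg : Φ.totalDegree ≤ D₀) : Φ.support.card ≤ (D₀ + 1) ^ Fintype.card σ := by
  classical
  let F : (σ →₀ ℕ) → (σ → Fin (D₀ + 1)) := fun α i =>
    ⟨min (α i) D₀, Nat.lt_succ_of_le (min_le_right _ _)⟩
  have hinj : Set.InjOn F Φ.support := by
    intro α hα β hβ hF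
    ext i
    have h := congrArg (fun f : σ → Fin (D₀ + 1) => ((f i : Fin (D₀ + 1)) : ℕ)) hF
    simp only [F] at h
    rwa [min_eq_left (apply_le_of_mem_support hdeg hα i),
      min_eq_left (apply_le_of_mem_support hdeg hβ i)] at h
  calc Φ.support.card ≤ (Finset.univ : Finset (σ → Fin (D₀ + 1))).card :=
        Finset.card_le_card_of_injOn F (fun α _ => Finset.mem_univ _) hinj
    _ = (D₀ + 1) ^ Fintype.card σ := by simp

/-- **Spreading one small monomial**: for an exponent `α` of degree `≥ 3` and a coefficient with
`|e| 2^{|α|} ≤ θ`, the polynomial `θ Σ Xᵢ² + e X^α` lies in the module with degree-`|α|`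
certificates (write `X^α = XᵢXⱼX^w`, spread `θ Σ X_m²` as `θ/2 (Xᵢ² + Xⱼ²)` plus squares, and use
the polarised identity). [cite: Marshall2008, Prop. 5.2.3] -/
theorem inQM_sumSq_add_monomial [DecidableEq σ] (c : σ → ℝ) (hc : ∑ i, c i ^ 2 ≤ 1)
    (α : σ →₀ ℕ) (hα : 3 ≤ α.degree) {θ e : ℝ} (hθ : 0 < θ) (he : |e| * (2 : ℝ) ^ α.degree ≤ θ) :
    InQM α.degree (shift c (unitBallPoly σ)) (C θ * ∑ m, X m ^ 2 + monomial α e) := by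
  obtain ⟨w, hw, hlen⟩ := Literature.RingTheory.MvPolynomial.exists_counts_eq α
  match w, hw, hlen with
  | [], _, hlen => simp at hlen; omega
  | [_], _, hlen => simp at hlen; omega
  | i :: j :: w', hw, hlen =>
    have hmon : (monomial α e : MvPolynomial σ ℝ) = C e * (X i * X j * wordMonomial w') := by
      rw [show (X i * X j * wordMonomial w' : MvPolynomial σ ℝ) = wordMonomial (i :: j :: w') by
          simp [wordMonomial_cons, mul_assoc], wordMonomial_eq_monomial, hw, C_mul_monomial, mul_one]
    have hlen' : w'.length + 2 = α.degree := by simp at hlen; omega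
    have he' : |e| * (2 : ℝ) ^ (w'.length + 1) ≤ θ / 2 := by
      rw [← hlen', pow_succ] at he; linarith
    have hpol := inQM_polarised c hc i j w' (half_pos hθ) he'
    have hsplit : (C θ * ∑ m, X m ^ 2 : MvPolynomial σ ℝ) =
        C (θ / 2) * (X i ^ 2 + X j ^ 2) + (C (θ / 2) * ∑ m ∈ Finset.univ.erase i, X m ^ 2 +
          C (θ / 2) * ∑ m ∈ Finset.univ.erase j, X m ^ 2) := by
      have hi := Finset.add_sum_erase Finset.univ (fun m : σ => (X m : MvPolynomial σ ℝ) ^ 2)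
        (Finset.mem_univ i)
      have hj := Finset.add_sum_erase Finset.univ (fun m : σ => (X m : MvPolynomial σ ℝ) ^ 2)
        (Finset.mem_univ j)
      have h2 : (C θ : MvPolynomial σ ℝ) = C (θ / 2) + C (θ / 2) := by rw [← map_add]; congr 1; ring
      rw [h2]
      linear_combination (-(C (θ / 2) : MvPolynomial σ ℝ)) * hi - (C (θ / 2) : MvPolynomial σ ℝ) * hj
    have hX : ∀ l : σ, (X l : MvPolynomial σ ℝ).totalDegree ≤ α.degree := fun l => by
      rw [totalDegree_X]; omega
    rw [hsplit, hmon, add_assoc, add_comm (C (θ / 2) * _ + _), ← add_assoc]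
    refine InQM.add (InQM.of_eq (by ring) (hlen' ▸ hpol)) (InQM.add ?_ ?_) <;>
    · rw [Finset.mul_sum]
      exact InQM.sum _ _ fun m _ => (InQM.sq _ (hX m)).smul (half_pos hθ).le

/-- **The perturbation lemma.** Let `A` be a real symmetric matrix with `A - δ·1 ⪰ 0` (`δ > 0`)
and `Φ₃` a polynomial supported in degrees `3 … D₀` whose coefficients satisfy
`|coeff| · (D₀+1)^{#σ} 2^{D₀} ≤ δ`. Then `Σ Aᵢⱼ XᵢXⱼ + Φ₃` lies in the degree-`D₀` truncated
quadratic module of the shifted unit ball `1 - Σ (Xᵢ + cᵢ)²`, for every centre with `Σ cᵢ² ≤ 1`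
— "a definite quadratic form plus a small perturbation is a sum of squares modulo the ball", the
elementary substitute for Helton–Nie's degree-bounded matrix Positivstellensatz on small balls.
[cite: Marshall2008, Cor. 5.2.4] [cite: HeltonNie2008, Theorem 29 (replaced)] -/
theorem InQM.of_quadratic_perturbation [DecidableEq σ] {δ : ℝ} (hδ : 0 < δ) {A : Matrix σ σ ℝ}
    (hA : (A - δ • (1 : Matrix σ σ ℝ)).PosSemidef) {Φ₃ : MvPolynomial σ ℝ} {D₀ : ℕ} (hD₀ : 2 ≤ D₀)
    (h3 : ∀ α ∈ Φ₃.support, 3 ≤ α.degree) (hdeg : Φ₃.totalDegree ≤ D₀)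
    (hsmall : ∀ α ∈ Φ₃.support, |coeff α Φ₃| * ((D₀ + 1) ^ Fintype.card σ * (2 : ℝ) ^ D₀) ≤ δ)
    (c : σ → ℝ) (hc : ∑ i, c i ^ 2 ≤ 1) :
    InQM D₀ (shift c (unitBallPoly σ)) (quadPoly A + Φ₃) := by
  have hD1 : 1 ≤ D₀ := by omega
  have hquad : quadPoly A = quadPoly (A - δ • (1 : Matrix σ σ ℝ)) + C δ * ∑ i, X i ^ 2 := by
    rw [quadPoly_sub, quadPoly_smul_one]; ring
  have hQ := inQM_quadPoly_of_posSemidef hA hD1 (shift c (unitBallPoly σ))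
  rw [hquad, add_assoc]
  refine hQ.add ?_
  -- spread `δ Σ Xᵢ²` over the support of `Φ₃`
  rcases Φ₃.support.eq_empty_or_nonempty with hI | hI
  · rw [MvPolynomial.support_eq_empty.1 hI, add_zero, Finset.mul_sum]
    exact InQM.sum _ _ fun i _ => (InQM.sq _ (by rw [totalDegree_X]; exact hD1)).smul hδ.le
  · have hcard : (0 : ℝ) < Φ₃.support.card := by exact_mod_cast hI.card_pos
    have hN : (Φ₃.support.card : ℝ) ≤ (D₀ + 1) ^ Fintype.card σ := by
      exact_mod_cast card_support_le_of_totalDegree_le hdeg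
    set θ : ℝ := δ / Φ₃.support.card with hθ
    have hθpos : 0 < θ := div_pos hδ hcard
    have hcθ : (Φ₃.support.card : ℝ) * θ = δ := by rw [hθ]; field_simp
    have hsplit : (C δ * ∑ i, X i ^ 2 : MvPolynomial σ ℝ) + Φ₃ =
        ∑ α ∈ Φ₃.support, (C θ * ∑ i, X i ^ 2 + monomial α (coeff α Φ₃)) := by
      rw [Finset.sum_add_distrib, Finset.sum_const, nsmul_eq_mul, ← mul_assoc,
        ← map_natCast (C : ℝ →+* MvPolynomial σ ℝ), ← map_mul, hcθ, ← Φ₃.as_sum]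
    rw [hsplit]
    refine InQM.sum _ _ fun α hα => ?_
    have hαdeg : α.degree ≤ D₀ := (le_totalDegree hα).trans hdeg
    refine (inQM_sumSq_add_monomial c hc α (h3 α hα) hθpos ?_).mono hαdeg
    -- the smallness bookkeeping
    have h2pow : (2 : ℝ) ^ α.degree ≤ (2 : ℝ) ^ D₀ := pow_le_pow_right₀ (by norm_num) hαdeg
    have habs := abs_nonneg (coeff α Φ₃)
    have hs := hsmall α hα
    rw [hθ, le_div_iff₀ hcard]
    calc |coeff α Φ₃| * (2 : ℝ) ^ α.degree * Φ₃.support.card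
        ≤ |coeff α Φ₃| * ((D₀ + 1) ^ Fintype.card σ * (2 : ℝ) ^ D₀) := by
          rw [mul_assoc]; refine mul_le_mul_of_nonneg_left ?_ habs
          rw [mul_comm]; exact mul_le_mul hN h2pow (by positivity) (by positivity)
      _ ≤ δ := hs

end Quadratic

end Literature.AlgebraicGeometry.HyperbolicPolynomials
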